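import Summits.ValiantsHypothesis.ValiantsHypothesis.Theorems.LacunarySymmetroidMatrixDescartesCensusPivotTwoPairBudget
import Summits.ValiantsHypothesis.ValiantsHypothesis.Theorems.LacunarySymmetroidMatrixDescartesCensusPivotKit

/-!
# `MatrixDescartes` census — pivot column at `m = 2`: the SMALL ROWS `(2,1) = 2` and `(2,2) = 4` (exact, every index `≥ 2`)

HONEST FRAMING.  Object-search cell `pub-symmetroid`, Conjecture-B column in PIVOT currency (`…CensusPivotDefs.lean`, seat conjb-1),
seat `val-sym-mdr-p1` (generation 6).  Helper file landed `--supports` the crux item stmt-ValiantsHypothesis-18050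
(`Theses.LacunarySymmetroid.MatrixDescartes`, OPEN, on HOLD) with NO closure claim.  Bookkeeping rows of the `(2, K)` pivot column
(lineage conjecture `Z₊ ≤ 2K`; kernel so far: `≤ 2K + 2` every `K` (conjb-1), `(2,3) = 6` exact (g5), `(2,4) ≥ 8` (g5); the cases
`K = 1, 2` were quoted «by Descartes» but not in the tree):
* **`pivotRootLawAt_two_one`**: `PivotRootLawAt 2 1 q 2` for every `q` (the two pivot degrees `2e`, `e + d` are never separated by the
  one pair sum `2d`; g4's pair budget); **`not_pivotRootLawAt_two_one_two_one`**: `J = −1`, `P = diag(1, 4)`, `det (tP − 1) = (t−1)(4t−1)`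
  has two positive roots, so **`pivotRootLawAt_two_one_two_iff : PivotRootLawAt 2 1 2 B ↔ 2 ≤ B`** (at index `≤ 1` the row is `≤ 1`
  by R0, `…CensusPivotIndexRung`, since one letter is always one-sided).
* **`pivotRootLawAt_two_two`**: `PivotRootLawAt 2 2 q 4` for every `q` (in every exponent configuration some two adjacent pivot degrees
  among `2e, e + d₀, e + d₁` have no pair sum strictly between them — a six-case check — so g4's pair budget gives `2K = 4`);
  **`not_pivotRootLawAt_two_two_two_three`**: `J = −1`, letters `diag(1/10, 2)` at exponent `0` and `diag(2, 1/10)` at exponent `2`,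
  pivot exponent `1`: `det F(t) = (2t² − t + 1/10)(t²/10 − t + 2)` has FOUR positive roots (signs `+ − + − +` at
  `1/10 < 1/4 < 1 < 5 < 10`), so **`pivotRootLawAt_two_two_two_iff : PivotRootLawAt 2 2 2 B ↔ 4 ≤ B`**.
So the kernel column at `m = 2` reads: `(2,1) = 2`, `(2,2) = 4`, `(2,3) = 6`, `(2,4) ∈ {8, 9, 10}` — `2K` through `K = 3`.
Nothing here bears on `Theses.LacunarySymmetroid.MatrixDescartes` in its window, on `KPlusLogSqLaw`, on `DoorA26` / `DoorA34`, on the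
cell's registers or credences, or on `VP ≠ VNP`.

[folklore] Descartes with a pair budget (tree `WLawTwoChambers.pivotTwo_posRoots_le_of_pair`, `Pivot.TwoDescartes.*`), intermediate
value theorem via the tree's certificate kit (`Pivot.not_pivotRootLawAt_of_certificate`).  No definitions, no named facts.
-/

-- `Summit.ValiantsHypothesis.ValiantsHypothesis.…` repeats a component by the D-0017 layout
-- (single-conjunct summit), which the `dupNamespace` linter flags; the name is mandated.
set_option linter.dupNamespace false

namespace Summit.ValiantsHypothesis.ValiantsHypothesis.Theorems.LacunarySymmetroidMatrixDescartes.Pivot.SmallRows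

open Matrix Finset Polynomial
open scoped BigOperators
open Pivot.TwoDescartes (letter expo pencil_eq_sum card_posRoots_le_two_mul_card coeff_det_nonneg_of_not_mem)
open WLawTwoChambers (pivotTwo_posRoots_le_of_pair)

/-! ## 1. All letters at the pivot exponent: `Z₊ ≤ 2` -/

/-- If every letter sits at the pivot exponent, `det F = X^{2e} det(J + ∑ Pₖ)` has only the pivot square as a possibly negative
coefficient, so `Z₊ ≤ 2`. [folklore] -/
theorem card_posRoots_le_two_of_all_at_pivot {K : ℕ} (e : ℕ) (d : Fin K → ℕ) (J : Matrix (Fin 2) (Fin 2) ℝ)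
    (P : Fin K → Matrix (Fin 2) (Fin 2) ℝ) (hP : ∀ k, (P k).PosSemidef) (hd : ∀ k, d k = e) :
    ((Matrix.det (((X : ℝ[X]) ^ e) • J.map Polynomial.C
        + ∑ k, ((X : ℝ[X]) ^ d k) • (P k).map Polynomial.C)).roots.toFinset.filter (fun t => 0 < t)).card ≤ 2 := by
  classical
  rw [pencil_eq_sum]
  have h := card_posRoots_le_two_mul_card
    (Matrix.det (∑ l, ((X : ℝ[X]) ^ expo e d l) • (letter J P l).map Polynomial.C)) {e + e} (fun n hn => ?_)
  · simpa using h
  · by_contra hnot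
    rw [Finset.mem_singleton] at hnot
    have hn' : ∀ l, e + expo e d l ≠ n := by
      intro l hl
      rcases l with _ | k
      · exact hnot (by rw [← hl]; rfl)
      · apply hnot
        rw [← hl]
        change e + d k = e + e
        rw [hd k]
    exact absurd hn (not_lt.mpr (coeff_det_nonneg_of_not_mem e d J P hP n hn'))

/-! ## 2. `K = 1`: `Z₊ ≤ 2` -/

/-- **`(2,1)`: `Z₊ ≤ 2`** for every `2 × 2` pivot pencil with one PSD letter (`J` any real `2 × 2` matrix). [folklore] -/
theorem card_posRoots_le_two_of_one_letter (e : ℕ) (d : Fin 1 → ℕ) (J : Matrix (Fin 2) (Fin 2) ℝ)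
    (P : Fin 1 → Matrix (Fin 2) (Fin 2) ℝ) (hP : ∀ k, (P k).PosSemidef) :
    ((Matrix.det (((X : ℝ[X]) ^ e) • J.map Polynomial.C
        + ∑ k, ((X : ℝ[X]) ^ d k) • (P k).map Polynomial.C)).roots.toFinset.filter (fun t => 0 < t)).card ≤ 2 := by
  have hexpo : ∀ l : Option (Fin 1), expo e d l = e ∨ expo e d l = d 0 := by
    intro l
    rcases l with _ | k
    · exact Or.inl rfl
    · right; fin_cases k; rfl
  rcases lt_trichotomy (d 0) e with hlt | heq | hgt
  · -- letter below the pivot: degrees `e + d₀ < 2e`, the pair sum `2d₀` lies below both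
    simpa using pivotTwo_posRoots_le_of_pair e d J P hP (e + d 0) (e + e) (by omega) ⟨some 0, rfl⟩ ⟨none, rfl⟩
      (fun l l' h => by rcases hexpo l with h1 | h1 <;> rcases hexpo l' with h2 | h2 <;> rw [h1, h2] at h <;> omega)
  · exact card_posRoots_le_two_of_all_at_pivot e d J P hP (fun k => by fin_cases k; exact heq)
  · simpa using pivotTwo_posRoots_le_of_pair e d J P hP (e + e) (e + d 0) (by omega) ⟨none, rfl⟩ ⟨some 0, rfl⟩
      (fun l l' h => by rcases hexpo l with h1 | h1 <;> rcases hexpo l' with h2 | h2 <;> rw [h1, h2] at h <;> omega)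

/-- **Row `(2,1)`: `PivotRootLawAt 2 1 q 2` for every index `q`.** (At index `≤ 1` the sharper `Z₊ ≤ 1` is the tree's R0, since one
letter is always one-sided.) [folklore] -/
theorem pivotRootLawAt_two_one (q : ℕ) : PivotRootLawAt 2 1 q 2 := by
  intro e d J P _hJ hP _hW
  exact card_posRoots_le_two_of_one_letter e d J P hP

/-! ## 3. `K = 2`: `Z₊ ≤ 4` -/

/-- The six-case check, for the two letters listed in increasing exponent order. [folklore] -/
theorem card_posRoots_le_four_aux (e : ℕ) (d : Fin 2 → ℕ) (J : Matrix (Fin 2) (Fin 2) ℝ)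
    (P : Fin 2 → Matrix (Fin 2) (Fin 2) ℝ) (hP : ∀ k, (P k).PosSemidef) (k₁ k₂ : Fin 2) (hle : d k₁ ≤ d k₂)
    (hcov : ∀ k, d k = d k₁ ∨ d k = d k₂) :
    ((Matrix.det (((X : ℝ[X]) ^ e) • J.map Polynomial.C
        + ∑ k, ((X : ℝ[X]) ^ d k) • (P k).map Polynomial.C)).roots.toFinset.filter (fun t => 0 < t)).card ≤ 4 := by
  have hexpo : ∀ l : Option (Fin 2), expo e d l = e ∨ expo e d l = d k₁ ∨ expo e d l = d k₂ := by
    intro l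
    rcases l with _ | k
    · exact Or.inl rfl
    · right; exact hcov k
  -- the pair budget, with the gap condition discharged by linear arithmetic from the case hypotheses
  have pair : ∀ u v : ℕ, u < v → (∃ l, e + expo e d l = u) → (∃ l, e + expo e d l = v) →
      (∀ s s' : ℕ, (s = e ∨ s = d k₁ ∨ s = d k₂) → (s' = e ∨ s' = d k₁ ∨ s' = d k₂) → ¬ (u < s + s' ∧ s + s' < v)) →
      ((Matrix.det (((X : ℝ[X]) ^ e) • J.map Polynomial.C
        + ∑ k, ((X : ℝ[X]) ^ d k) • (P k).map Polynomial.C)).roots.toFinset.filter (fun t => 0 < t)).card ≤ 4 := by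
    intro u v huv hu hv hgap
    simpa using pivotTwo_posRoots_le_of_pair e d J P hP u v huv hu hv (fun l l' => hgap _ _ (hexpo l) (hexpo l'))
  by_cases hall : d k₁ = e ∧ d k₂ = e
  · -- everything at the pivot
    refine (card_posRoots_le_two_of_all_at_pivot e d J P hP fun k => ?_).trans (by norm_num)
    rcases hcov k with h | h
    · rw [h, hall.1]
    · rw [h, hall.2]
  rcases le_or_gt (d k₂) e with h₂ | h₂
  · -- both letters at or below the pivot, not both at it: `d k₁ < e`
    have h₁ : d k₁ < e := by
      rcases lt_or_eq_of_le (hle.trans h₂) with h | h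
      · exact h
      · exact absurd ⟨h, le_antisymm h₂ (h ▸ hle)⟩ hall
    rcases lt_or_eq_of_le h₂ with h₂' | h₂'
    · -- `d k₁ ≤ d k₂ < e`: the pivot degrees `e + d k₂ < 2e` are adjacent and unseparated
      exact pair (e + d k₂) (e + e) (by omega) ⟨some k₂, rfl⟩ ⟨none, rfl⟩ (fun s s' hs hs' => by omega)
    · -- `d k₁ < d k₂ = e`
      exact pair (e + d k₁) (e + e) (by omega) ⟨some k₁, rfl⟩ ⟨none, rfl⟩ (fun s s' hs hs' => by omega)
  · rcases le_or_gt e (d k₁) with h₁ | h₁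
    · -- both at or above the pivot, `d k₂ > e`
      rcases lt_or_eq_of_le h₁ with h₁' | h₁'
      · -- `e < d k₁ ≤ d k₂`
        exact pair (e + e) (e + d k₁) (by omega) ⟨none, rfl⟩ ⟨some k₁, rfl⟩ (fun s s' hs hs' => by omega)
      · -- `e = d k₁ < d k₂`
        exact pair (e + e) (e + d k₂) (by omega) ⟨none, rfl⟩ ⟨some k₂, rfl⟩ (fun s s' hs hs' => by omega)
    · -- two-sided: `d k₁ < e < d k₂`
      rcases le_or_gt (e + e) (d k₁ + d k₂) with hs | hs
      · exact pair (e + d k₁) (e + e) (by omega) ⟨some k₁, rfl⟩ ⟨none, rfl⟩ (fun s s' hs hs' => by omega)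
      · exact pair (e + e) (e + d k₂) (by omega) ⟨none, rfl⟩ ⟨some k₂, rfl⟩ (fun s s' hs hs' => by omega)

/-- **`(2,2)`: `Z₊ ≤ 4`** for every `2 × 2` pivot pencil with two PSD letters (`J` any real `2 × 2` matrix, any exponents). [folklore] -/
theorem card_posRoots_le_four_of_two_letters (e : ℕ) (d : Fin 2 → ℕ) (J : Matrix (Fin 2) (Fin 2) ℝ)
    (P : Fin 2 → Matrix (Fin 2) (Fin 2) ℝ) (hP : ∀ k, (P k).PosSemidef) :
    ((Matrix.det (((X : ℝ[X]) ^ e) • J.map Polynomial.C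
        + ∑ k, ((X : ℝ[X]) ^ d k) • (P k).map Polynomial.C)).roots.toFinset.filter (fun t => 0 < t)).card ≤ 4 := by
  rcases le_total (d 0) (d 1) with h | h
  · exact card_posRoots_le_four_aux e d J P hP 0 1 h (fun k => by fin_cases k <;> simp)
  · exact card_posRoots_le_four_aux e d J P hP 1 0 h (fun k => by fin_cases k <;> simp)

/-- **Row `(2,2)`: `PivotRootLawAt 2 2 q 4` for every index `q`.** [folklore] -/
theorem pivotRootLawAt_two_two (q : ℕ) : PivotRootLawAt 2 2 q 4 := by
  intro e d J P _hJ hP _hW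
  exact card_posRoots_le_four_of_two_letters e d J P hP

/-! ## 4. Sharpness at index two -/

/-- Closed form for the `(2,1)` witness: `J = −1`, `P = diag(1, 4)` at exponent `1`, pivot exponent `0`:
`det (tP − 1) = (t − 1)(4t − 1)`. [folklore] -/
theorem witnessOne_eval_det (t : ℝ) :
    (t ^ 0 • (!![-1, 0; 0, -1] : Matrix (Fin 2) (Fin 2) ℝ)
      + ∑ k, t ^ (![1] : Fin 1 → ℕ) k • (![Matrix.diagonal ![1, 4]] : Fin 1 → Matrix (Fin 2) (Fin 2) ℝ) k).det
      = (t - 1) * (4 * t - 1) := by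
  rw [Matrix.det_fin_two]
  simp [Matrix.add_apply, Matrix.smul_apply, Matrix.diagonal_apply_eq, Matrix.diagonal_apply_ne]
  ring

/-- **`(2,1)` is sharp at index two**: `¬ PivotRootLawAt 2 1 2 1` (two positive roots `1/4`, `1`). [folklore] -/
theorem not_pivotRootLawAt_two_one_two_one : ¬ PivotRootLawAt 2 1 2 1 :=
  not_pivotRootLawAt_of_certificate (N := 2) witnessOne_eval_det
    (by unfold Matrix.IsSymm; ext i j; fin_cases i <;> fin_cases j <;> rfl)
    (by intro k; fin_cases k; simp [Matrix.posSemidef_diagonal_iff, Fin.forall_fin_two])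
    (1 : Matrix (Fin 2) (Fin 2) ℝ)
    (by
      have h : (!![-1, 0; 0, -1] : Matrix (Fin 2) (Fin 2) ℝ) + 1 * (1 : Matrix (Fin 2) (Fin 2) ℝ)ᵀ = 0 := by
        ext i j; fin_cases i <;> fin_cases j <;> simp
      rw [h]; exact Matrix.PosSemidef.zero)
    ![1 / 10, 1 / 2, 2]
    (by
      refine Fin.strictMono_iff_lt_succ.2 fun j => ?_
      fin_cases j <;> simp only [Fin.castSucc_mk, Fin.succ_mk] <;> norm_num)
    (by intro j; fin_cases j <;> norm_num)
    (by intro j; fin_cases j <;> simp only [Fin.castSucc_mk, Fin.succ_mk] <;> norm_num)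
    (by norm_num)

/-- **Row `(2,1)` at index two is exactly `2`**: `PivotRootLawAt 2 1 2 B ↔ 2 ≤ B`. [folklore] -/
theorem pivotRootLawAt_two_one_two_iff (B : ℕ) : PivotRootLawAt 2 1 2 B ↔ 2 ≤ B := by
  constructor
  · intro h
    by_contra hB
    exact not_pivotRootLawAt_two_one_two_one (pivotRootLawAt_mono h (by omega))
  · intro hB
    exact pivotRootLawAt_mono (pivotRootLawAt_two_one 2) hB

/-- Closed form for the `(2,2)` witness: `J = −1` at exponent `1`, letters `diag(1/10, 2)` at `0` and `diag(2, 1/10)` at `2`: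
`det F(t) = (2t² − t + 1/10)(t²/10 − t + 2)`. [folklore] -/
theorem witnessTwo_eval_det (t : ℝ) :
    (t ^ 1 • (!![-1, 0; 0, -1] : Matrix (Fin 2) (Fin 2) ℝ)
      + ∑ k, t ^ (![0, 2] : Fin 2 → ℕ) k •
        (![Matrix.diagonal ![1 / 10, 2], Matrix.diagonal ![2, 1 / 10]] : Fin 2 → Matrix (Fin 2) (Fin 2) ℝ) k).det
      = (2 * t ^ 2 - t + 1 / 10) * (t ^ 2 / 10 - t + 2) := by
  rw [Matrix.det_fin_two]
  simp [Matrix.add_apply, Matrix.smul_apply, Fin.sum_univ_two, Matrix.diagonal_apply_eq, Matrix.diagonal_apply_ne]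
  ring

/-- **`(2,2)` is sharp at index two**: `¬ PivotRootLawAt 2 2 2 3` (four positive roots; signs `+ − + − +` at
`1/10 < 1/4 < 1 < 5 < 10`). [folklore] -/
theorem not_pivotRootLawAt_two_two_two_three : ¬ PivotRootLawAt 2 2 2 3 :=
  not_pivotRootLawAt_of_certificate (N := 4) witnessTwo_eval_det
    (by unfold Matrix.IsSymm; ext i j; fin_cases i <;> fin_cases j <;> rfl)
    (by intro k; fin_cases k <;> simp [Matrix.posSemidef_diagonal_iff, Fin.forall_fin_two])
    (1 : Matrix (Fin 2) (Fin 2) ℝ)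
    (by
      have h : (!![-1, 0; 0, -1] : Matrix (Fin 2) (Fin 2) ℝ) + 1 * (1 : Matrix (Fin 2) (Fin 2) ℝ)ᵀ = 0 := by
        ext i j; fin_cases i <;> fin_cases j <;> simp
      rw [h]; exact Matrix.PosSemidef.zero)
    ![1 / 10, 1 / 4, 1, 5, 10]
    (by
      refine Fin.strictMono_iff_lt_succ.2 fun j => ?_
      fin_cases j <;> simp only [Fin.castSucc_mk, Fin.succ_mk] <;> norm_num)
    (by intro j; fin_cases j <;> norm_num)
    (by intro j; fin_cases j <;> simp only [Fin.castSucc_mk, Fin.succ_mk] <;> norm_num)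
    (by norm_num)

/-- **Row `(2,2)` at index two is exactly `4`**: `PivotRootLawAt 2 2 2 B ↔ 4 ≤ B`. [folklore] -/
theorem pivotRootLawAt_two_two_two_iff (B : ℕ) : PivotRootLawAt 2 2 2 B ↔ 4 ≤ B := by
  constructor
  · intro h
    by_contra hB
    exact not_pivotRootLawAt_two_two_two_three (pivotRootLawAt_mono h (by omega))
  · intro hB
    exact pivotRootLawAt_mono (pivotRootLawAt_two_two 2) hB

end Summit.ValiantsHypothesis.ValiantsHypothesis.Theorems.LacunarySymmetroidMatrixDescartes.Pivot.SmallRows
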